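import Literature.Topology.FourManifolds.UnorientedDiscTheorem
import Literature.Topology.FourManifolds.PalaisBallComplement
import Literature.Topology.FourManifolds.ConnectedSumData
import Literature.Topology.FourManifolds.NonSeparatingSpheresReduction
import HarnessLib

/-!
# Inflating the flat tube of a non-separating sphere (Budney–Gabai Thm. 3.13, Cerf–Palais step, I)

Fact seat of `Literature.Topology.FourManifolds.BudneyGabai2019_thm_3_13` (`NonSeparatingSpheres.lean`;
R. Budney, D. Gabai, *Knotted 3-balls in `S⁴`*, arXiv:1912.09029 (v2), Thm. 3.13).
`NonSeparatingSpheresDrill.lean` leaves a smoothly embedded non-separating sphere `K ⊆ S¹ × Sⁿ`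
which is *flat over a tube*: `K ∩ (S¹ × B̄(p₀, r)) = {1} × B̄(p₀, r)` for some (small) `r > 0`,
and reduces Thm. 3.13 (`n ≥ 3`) to the statement that such a `K` is standard (hypothesis `Hred`
of `exists_image_eq_range_standardSphere_of_reducingBall` = Budney–Gabai Thm. 3.12 in
`S¹ × Bⁿ`, to be proved along the source's remark after Thm. 3.12: *"attach a `Sⁿ⁻¹ × D²` to
obtain `Sⁿ⁺¹` … By the Cerf–Palais theorem there is a diffeomorphism of this sphere taking `Δ₁`
to a standard `n`-ball"*).  This file performs the preliminary normalisation of the flat tube: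

* `exists_diffeomorph_flat_below` — for every latitude `ℓ ∈ (-1, 1)` there is a diffeomorphism
  `Ψ = id × h` of `S¹ × Sⁿ` (`n ≥ 1`) after which the sphere is flat over the whole sub-level tube
  of the first coordinate: `(Ψ ∘ e)(Sⁿ) ∩ (S¹ × {p₀ ≤ ℓ}) = {1} × {p₀ ≤ ℓ}`; the reducing ball is
  thereby confined to the thin solid torus `S¹ × {p₀ > ℓ}` about the circle `S¹ × {north pole}`.
  Here `h` is a rotation of `Sⁿ` (a hyperplane reflection, `Submodule.reflection_sub`, acting by
  `LinearIsometryEquiv.sphereDiffeomorph`) moving `p₀` to the south pole, followed by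
* `exists_diffeomorph_image_cap_eq` — **any two round caps `{⟪p, v⟫ ≤ ℓᵢ}` of a round sphere of
  dimension `≥ 1` are equivalent under a diffeomorphism of the sphere**: the disc theorem of
  Palais–Cerf in the tree's unoriented compactly supported form
  (`exists_diffeomorph_apply_disc_eq_or_reflect_cs`, `UnorientedDiscTheorem.lean`; Hirsch (1976),
  Ch. 8 §3, Thm. 3.1) applied to the stereographic discs `y ↦ σᵥ⁻¹(cᵢ y)`, which fill exactly the
  caps (`image_stereographic'_symm_smul_closedBall`, from the height formula
  `⟪σᵥ⁻¹ x, v⟫ = (‖x‖² − 4)/(‖x‖² + 4)` of `PalaisBallComplement.lean`); caps are the metric balls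
  about `-v` (`closedBall_neg_eq_setOf_inner_le`).
* `image_prodCongr_inter_eq` — bookkeeping: flatness over `S¹ × A` is transported by `id × h` to
  flatness over `S¹ × h(A)`.

Everything here is proved; no definitions and no named facts are introduced.

## References

* R. Budney, D. Gabai, *Knotted 3-balls in `S⁴`*, arXiv:1912.09029 (v2), §3, Thm. 3.12 and the
  remark following it, proof of Thm. 3.13 (p. 22). [BudneyGabai2019]
* M. W. Hirsch, *Differential Topology*, GTM 33 (1976), Ch. 8 §3, Thm. 3.1 (disc theorem).
  [HirschDT1976]
* R. Palais, *Extending diffeomorphisms*, Proc. AMS 11 (1960), Thm. B. [Palais1960]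
-/

noncomputable section

open scoped Manifold ContDiff Topology Real RealInnerProductSpace
open Set Function Metric Module

namespace Literature.Topology.FourManifolds

namespace BudneyGabai2019_thm_3_13

variable {n : ℕ}

/-! ### Round caps as stereographic discs -/

/-- The height of a point of the round sphere over the equator orthogonal to `v` is at most `1`,
with equality only at `v`. [folklore] -/
theorem real_inner_le_one_of_mem_sphere {V : Type*} [NormedAddCommGroup V] [InnerProductSpace ℝ V]
    (p v : sphere (0 : V) 1) : ⟪(p : V), (v : V)⟫ ≤ 1 := by
  have h := real_inner_le_norm (p : V) (v : V)
  rw [norm_eq_of_mem_sphere p, norm_eq_of_mem_sphere v, mul_one] at h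
  exact h

/-- **The scaled inverse stereographic projection maps the closed unit ball onto a round cap**:
`σᵥ⁻¹(λ 𝔻ⁿ) = {p | ⟪p, v⟫ ≤ (λ² − 4)/(λ² + 4)}` (`λ > 0`), by the height formula
`⟪σᵥ⁻¹ x, v⟫ = (‖x‖² − 4)/(‖x‖² + 4)`. [folklore] -/
theorem image_stereographic'_symm_smul_closedBall {V : Type*} [NormedAddCommGroup V]
    [InnerProductSpace ℝ V] [Fact (finrank ℝ V = n + 1)] (v : sphere (0 : V) 1) {c : ℝ}
    (hc : 0 < c) :
    (fun y : EuclideanSpace ℝ (Fin n) ↦ (stereographic' n v).symm (c • y)) '' closedBall 0 1 =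
      {p : sphere (0 : V) 1 | ⟪(p : V), (v : V)⟫ ≤ (c ^ 2 - 4) / (c ^ 2 + 4)} := by
  -- `t ↦ (t - 4)/(t + 4)` is increasing on `t ≥ 0`
  have hmono : ∀ s t : ℝ, 0 ≤ s → s ≤ t → (s - 4) / (s + 4) ≤ (t - 4) / (t + 4) := by
    intro s t hs hst
    rw [div_le_div_iff₀ (by linarith) (by linarith)]
    nlinarith
  have hmono' : ∀ s t : ℝ, 0 ≤ s → 0 ≤ t → (s - 4) / (s + 4) ≤ (t - 4) / (t + 4) → s ≤ t := by
    intro s t hs ht h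
    rw [div_le_div_iff₀ (by linarith) (by linarith)] at h
    nlinarith
  apply Subset.antisymm
  · rintro _ ⟨y, hy, rfl⟩
    rw [mem_closedBall_zero_iff] at hy
    show ⟪(((stereographic' n v).symm (c • y) : sphere (0 : V) 1) : V), (v : V)⟫ ≤ _
    rw [real_inner_stereographic'_symm_pole, norm_smul, Real.norm_of_nonneg hc.le]
    refine hmono _ _ (by positivity) ?_
    have h1 : c * ‖y‖ ≤ c := by nlinarith [norm_nonneg y]
    have h2 : 0 ≤ c * ‖y‖ := by positivity
    nlinarith [h1, h2]
  · intro p hp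
    have hp : ⟪(p : V), (v : V)⟫ ≤ (c ^ 2 - 4) / (c ^ 2 + 4) := hp
    have hlt : (c ^ 2 - 4) / (c ^ 2 + 4) < 1 := by
      rw [div_lt_one (by positivity)]; linarith
    have hpv : p ≠ v := by
      rintro rfl
      have h1 : ⟪(p : V), (p : V)⟫ = 1 := by
        rw [real_inner_self_eq_norm_sq, norm_eq_of_mem_sphere p]; norm_num
      linarith
    set x := stereographic' n v p with hx
    have hpx : (stereographic' n v).symm x = p := stereographic'_symm_apply_of_ne v hpv
    refine ⟨c⁻¹ • x, ?_, ?_⟩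
    · rw [mem_closedBall_zero_iff, norm_smul, norm_inv, Real.norm_of_nonneg hc.le]
      have hxn : ‖x‖ ^ 2 ≤ c ^ 2 := by
        have h := real_inner_stereographic'_symm_pole v x
        rw [hpx] at h
        rw [h] at hp
        exact hmono' _ _ (by positivity) (by positivity) hp
      have hxc : ‖x‖ ≤ c := by
        by_contra h
        push Not at h
        nlinarith [norm_nonneg x, h]
      calc c⁻¹ * ‖x‖ ≤ c⁻¹ * c := by gcongr
        _ = 1 := inv_mul_cancel₀ hc.ne'
    · show (stereographic' n v).symm (c • c⁻¹ • x) = p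
      rw [smul_smul, mul_inv_cancel₀ hc.ne', one_smul, hpx]

/-- The inverse stereographic projection `σᵥ⁻¹ : ℝⁿ → S` is a smooth embedding (the inverse
of a chart with full target; cf. `isSmoothEmbedding_symm_of_target_eq_univ`). [folklore] -/
theorem isSmoothEmbedding_stereographic'_symm' {V : Type*} [NormedAddCommGroup V]
    [InnerProductSpace ℝ V] [Fact (finrank ℝ V = n + 1)] (v : sphere (0 : V) 1) :
    Manifold.IsSmoothEmbedding (𝓡 n) (𝓡 n) ∞ (stereographic' n v).symm :=
  isSmoothEmbedding_symm_of_target_eq_univ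
    (IsManifold.subset_maximalAtlas (⟨v, rfl⟩ : stereographic' n v ∈
      atlas (EuclideanSpace ℝ (Fin n)) (sphere (0 : V) 1)))
    (stereographic'_target v)

/-- The scaled inverse stereographic projection `y ↦ σᵥ⁻¹ (c • y)` (`c ≠ 0`) is a smooth
embedding `ℝⁿ → S`. [folklore] -/
theorem isSmoothEmbedding_stereographic'_symm_smul {V : Type*} [NormedAddCommGroup V]
    [InnerProductSpace ℝ V] [Fact (finrank ℝ V = n + 1)] (v : sphere (0 : V) 1) {c : ℝ}
    (hc : c ≠ 0) :
    Manifold.IsSmoothEmbedding 𝓘(ℝ, EuclideanSpace ℝ (Fin n)) (𝓡 n) ∞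
      (fun y : EuclideanSpace ℝ (Fin n) ↦ (stereographic' n v).symm (c • y)) := by
  have h := (isSmoothEmbedding_stereographic'_symm' v).comp_diffeomorph
    (ContinuousLinearEquiv.smulLeft (Units.mk0 c hc) :
      EuclideanSpace ℝ (Fin n) ≃L[ℝ] EuclideanSpace ℝ (Fin n)).toDiffeomorph
  exact h

/-- A hyperplane reflection of `ℝⁿ` (`n ≥ 1`) of negative determinant, preserving the norm.
[folklore] -/
theorem exists_linearIsometryEquiv_det_neg (hn : 1 ≤ n) :
    ∃ r : EuclideanSpace ℝ (Fin n) ≃ₗᵢ[ℝ] EuclideanSpace ℝ (Fin n),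
      LinearMap.det (r.toContinuousLinearEquiv.toLinearEquiv :
        EuclideanSpace ℝ (Fin n) →ₗ[ℝ] EuclideanSpace ℝ (Fin n)) < 0 := by
  set e : EuclideanSpace ℝ (Fin n) := EuclideanSpace.single ⟨0, hn⟩ 1 with he
  have he0 : e ≠ 0 := by
    intro h
    have := congrArg (fun x : EuclideanSpace ℝ (Fin n) ↦ x ⟨0, hn⟩) h
    simp [he] at this
  refine ⟨((ℝ ∙ e)ᗮ).reflection, ?_⟩
  have h := ((ℝ ∙ e)ᗮ).det_reflection
  rw [Submodule.orthogonal_orthogonal, finrank_span_singleton he0, pow_one] at h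
  have h' : LinearMap.det (((ℝ ∙ e)ᗮ).reflection.toContinuousLinearEquiv.toLinearEquiv :
      EuclideanSpace ℝ (Fin n) →ₗ[ℝ] EuclideanSpace ℝ (Fin n)) = -1 := h
  rw [h']
  norm_num


/-- **Round caps are metric balls about the antipode of the pole**: in the unit sphere,
`B̄(-v, ρ) = {p | ⟪p, v⟫ ≤ ρ²/2 − 1}` (`ρ ≥ 0`), since `‖p + v‖² = 2 + 2⟪p, v⟫`. [folklore] -/
theorem closedBall_neg_eq_setOf_inner_le {V : Type*} [NormedAddCommGroup V] [InnerProductSpace ℝ V]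
    (v : sphere (0 : V) 1) {ρ : ℝ} (hρ : 0 ≤ ρ) :
    closedBall (-v) ρ = {p : sphere (0 : V) 1 | ⟪(p : V), (v : V)⟫ ≤ ρ ^ 2 / 2 - 1} := by
  ext p
  have hsq : ‖(p : V) + (v : V)‖ ^ 2 = 2 + 2 * ⟪(p : V), (v : V)⟫ := by
    rw [norm_add_sq_real, norm_eq_of_mem_sphere p, norm_eq_of_mem_sphere v]; ring
  rw [mem_closedBall, Subtype.dist_eq, dist_eq_norm]
  show ‖(p : V) - ((-v : sphere (0 : V) 1) : V)‖ ≤ ρ ↔ ⟪(p : V), (v : V)⟫ ≤ ρ ^ 2 / 2 - 1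
  rw [coe_neg_sphere, sub_neg_eq_add]
  constructor
  · intro h
    have h2 : ‖(p : V) + (v : V)‖ ^ 2 ≤ ρ ^ 2 := by gcongr
    linarith
  · intro h
    have h2 : ‖(p : V) + (v : V)‖ ^ 2 ≤ ρ ^ 2 := by linarith
    exact (abs_le_of_sq_le_sq' h2 hρ).2

/-- The scaling constant `c(ℓ) = √(4 (1 + ℓ)/(1 − ℓ))` of the stereographic disc filling the cap
`{⟪p, v⟫ ≤ ℓ}`: it is positive and `(c² − 4)/(c² + 4) = ℓ` (`-1 < ℓ < 1`). [folklore] -/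
theorem exists_capScale {ℓ : ℝ} (h1 : -1 < ℓ) (h2 : ℓ < 1) :
    ∃ c : ℝ, 0 < c ∧ (c ^ 2 - 4) / (c ^ 2 + 4) = ℓ := by
  have hq : 0 < 4 * (1 + ℓ) / (1 - ℓ) := div_pos (by linarith) (by linarith)
  refine ⟨Real.sqrt (4 * (1 + ℓ) / (1 - ℓ)), Real.sqrt_pos.2 hq, ?_⟩
  rw [Real.sq_sqrt hq.le]
  have h1l : (1 - ℓ) ≠ 0 := by linarith
  field_simp
  ring

/-- **Any two round caps of the sphere `Sⁿ` (`n ≥ 1`) are equivalent under a diffeomorphism**: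
for `-1 < ℓ₁, ℓ₂ < 1` some diffeomorphism of the unit sphere carries `{⟪p, v⟫ ≤ ℓ₁}` onto
`{⟪p, v⟫ ≤ ℓ₂}`.  This is the disc theorem of Palais–Cerf (tree:
`exists_diffeomorph_apply_disc_eq_or_reflect_cs`, Hirsch (1976), Ch. 8 §3, Thm. 3.1) applied to
the two stereographic discs `y ↦ σᵥ⁻¹(cᵢ y)` filling the caps (the possible reflection `r` of
the unoriented theorem preserves the closed unit ball).
[cite: HirschDT1976, Ch. 8 §3, Thm. 3.1] -/
theorem exists_diffeomorph_image_cap_eq {V : Type*} [NormedAddCommGroup V] [InnerProductSpace ℝ V]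
    [Fact (finrank ℝ V = n + 1)] (hn : 1 ≤ n) (v : sphere (0 : V) 1) {ℓ₁ ℓ₂ : ℝ}
    (h₁ : -1 < ℓ₁) (h₁' : ℓ₁ < 1) (h₂ : -1 < ℓ₂) (h₂' : ℓ₂ < 1) :
    ∃ h : (sphere (0 : V) 1) ≃ₘ⟮𝓡 n, 𝓡 n⟯ (sphere (0 : V) 1),
      h '' {p : sphere (0 : V) 1 | ⟪(p : V), (v : V)⟫ ≤ ℓ₁} =
        {p : sphere (0 : V) 1 | ⟪(p : V), (v : V)⟫ ≤ ℓ₂} := by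
  haveI : FiniteDimensional ℝ V := .of_fact_finrank_eq_succ (K := ℝ) (V := V) n
  -- the sphere is connected (`n ≥ 1`)
  haveI : ConnectedSpace (sphere (0 : V) 1) := by
    refine isConnected_iff_connectedSpace.mp (isConnected_sphere ?_ 0 zero_le_one)
    rw [← Module.finrank_eq_rank, (Fact.out : finrank ℝ V = n + 1)]
    exact_mod_cast Nat.succ_lt_succ hn
  obtain ⟨c₁, hc₁, hc₁'⟩ := exists_capScale h₁ h₁'
  obtain ⟨c₂, hc₂, hc₂'⟩ := exists_capScale h₂ h₂'
  have hi₁ := isSmoothEmbedding_stereographic'_symm_smul (n := n) v hc₁.ne'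
  have hi₂ := isSmoothEmbedding_stereographic'_symm_smul (n := n) v hc₂.ne'
  obtain ⟨r, hr⟩ := exists_linearIsometryEquiv_det_neg hn
  obtain ⟨f, -, hf⟩ := exists_diffeomorph_apply_disc_eq_or_reflect_cs (M := sphere (0 : V) 1)
    (by omega) hi₁ hi₂ r.toContinuousLinearEquiv hr
  refine ⟨f, ?_⟩
  rw [← hc₁', ← hc₂', ← image_stereographic'_symm_smul_closedBall (n := n) v hc₁,
    ← image_stereographic'_symm_smul_closedBall (n := n) v hc₂, image_image]
  rcases hf with hf | hf
  · apply Subset.antisymm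
    · rintro _ ⟨y, hy, rfl⟩
      exact ⟨y, hy, (hf y (mem_closedBall_zero_iff.1 hy)).symm⟩
    · rintro _ ⟨y, hy, rfl⟩
      exact ⟨y, hy, hf y (mem_closedBall_zero_iff.1 hy)⟩
  · -- the reflected case: `r` preserves the closed unit ball
    have hrn : ∀ y : EuclideanSpace ℝ (Fin n), ‖r y‖ = ‖y‖ := fun y ↦ r.norm_map y
    apply Subset.antisymm
    · rintro _ ⟨y, hy, rfl⟩
      refine ⟨r.symm y, ?_, ?_⟩
      · rw [mem_closedBall_zero_iff, r.symm.norm_map]; exact mem_closedBall_zero_iff.1 hy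
      · have := hf (r.symm y) (by rw [r.symm.norm_map]; exact mem_closedBall_zero_iff.1 hy)
        simp only [LinearIsometryEquiv.coe_toContinuousLinearEquiv,
          LinearIsometryEquiv.apply_symm_apply] at this
        exact this.symm
    · rintro _ ⟨y, hy, rfl⟩
      refine ⟨r y, ?_, ?_⟩
      · rw [mem_closedBall_zero_iff, hrn]; exact mem_closedBall_zero_iff.1 hy
      · exact hf y (mem_closedBall_zero_iff.1 hy)

/-! ### Transport of flatness along diffeomorphisms of the form `id × h` -/

/-- **Flatness over a region of the `Sⁿ`-factor is transported by `id × h`**: if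
`K ∩ (S¹ × A) = {1} × A` and `h` is a self-diffeomorphism of `Sⁿ`, then
`(id × h)(K) ∩ (S¹ × h(A)) = {1} × h(A)`. [folklore] -/
theorem image_prodCongr_inter_eq
    (h : (Metric.sphere (0 : EuclideanSpace ℝ (Fin (n + 1))) 1) ≃ₘ⟮𝓡 n, 𝓡 n⟯
      (Metric.sphere (0 : EuclideanSpace ℝ (Fin (n + 1))) 1))
    {K : Set (Circle × Metric.sphere (0 : EuclideanSpace ℝ (Fin (n + 1))) 1)}
    {A : Set (Metric.sphere (0 : EuclideanSpace ℝ (Fin (n + 1))) 1)}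
    (hK : K ∩ {q | q.2 ∈ A} = ({1} : Set Circle) ×ˢ A) :
    ((Diffeomorph.refl (𝓡 1) Circle ∞).prodCongr h) '' K ∩ {q | q.2 ∈ h '' A} =
      ({1} : Set Circle) ×ˢ (h '' A) := by
  set Ψ := (Diffeomorph.refl (𝓡 1) Circle ∞).prodCongr h with hΨ
  have hΨa : ∀ q : Circle × Metric.sphere (0 : EuclideanSpace ℝ (Fin (n + 1))) 1,
      Ψ q = (q.1, h q.2) := fun q ↦ rfl
  have hΨA : Ψ '' {q | q.2 ∈ A} = {q | q.2 ∈ h '' A} := by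
    ext q
    constructor
    · rintro ⟨q', hq', rfl⟩
      rw [hΨa]
      exact mem_image_of_mem h hq'
    · rintro ⟨p, hp, hpq⟩
      refine ⟨(q.1, p), hp, ?_⟩
      rw [hΨa]
      exact Prod.ext rfl hpq
  have hinj : Injective Ψ := EquivLike.injective Ψ
  rw [← hΨA, ← image_inter hinj, hK, hΨ, Diffeomorph.coe_prodCongr, prodMap_image_prod,
    Diffeomorph.coe_refl, image_id]

/-! ### The inflation -/

/-- **Inflating the flat tube.**  Let `e : Sⁿ → S¹ × Sⁿ` (`n ≥ 1`) be a smoothly embedded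
non-separating sphere which is flat over the closed tube about `S¹ × {p₀}` of chordal radius
`r > 0`: `e(Sⁿ) ∩ (S¹ × B̄(p₀, r)) = {1} × B̄(p₀, r)`.  Then for every latitude `ℓ ∈ (-1, 1)`
there is a diffeomorphism `Ψ` of `S¹ × Sⁿ` such that `Ψ ∘ e` (again a smoothly embedded
non-separating sphere) is flat over the whole sub-level tube of the height function
`p ↦ p₀` (first coordinate): `(Ψ ∘ e)(Sⁿ) ∩ (S¹ × {p₀ ≤ ℓ}) = {1} × {p₀ ≤ ℓ}`.  `Ψ = id × h`,
`h` a rotation of `Sⁿ` taking `p₀` to the south pole followed by the diffeomorphism of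
`exists_diffeomorph_image_cap_eq` (disc theorem) inflating the cap `B̄(south, min r 1)` to the cap
`{p₀ ≤ ℓ}`.  (First half of the "attach `Sⁿ⁻¹ × D²`" step of Budney–Gabai 2019, remark after
Thm. 3.12: it makes the reducing ball small, inside `S¹ × {p₀ > ℓ}`.)
[cite: BudneyGabai2019, Thm. 3.12, remark, and proof of Thm. 3.13 (arXiv:1912.09029 v2, p. 22)] -/
theorem exists_diffeomorph_flat_below (hn : 1 ≤ n)
    {e : Metric.sphere (0 : EuclideanSpace ℝ (Fin (n + 1))) 1 →
      Circle × Metric.sphere (0 : EuclideanSpace ℝ (Fin (n + 1))) 1}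
    (he : Manifold.IsSmoothEmbedding (𝓡 n) ((𝓡 1).prod (𝓡 n)) ∞ e)
    (hconn : IsConnected (range e)ᶜ)
    (p₀ : Metric.sphere (0 : EuclideanSpace ℝ (Fin (n + 1))) 1) {r : ℝ} (hr : 0 < r)
    (hflat : range e ∩ {q | q.2 ∈ closedBall p₀ r} = ({1} : Set Circle) ×ˢ closedBall p₀ r)
    {ℓ : ℝ} (hℓ : -1 < ℓ) (hℓ' : ℓ < 1) :
    ∃ Ψ : (Circle × Metric.sphere (0 : EuclideanSpace ℝ (Fin (n + 1))) 1) ≃ₘ⟮(𝓡 1).prod (𝓡 n),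
        (𝓡 1).prod (𝓡 n)⟯ (Circle × Metric.sphere (0 : EuclideanSpace ℝ (Fin (n + 1))) 1),
      Manifold.IsSmoothEmbedding (𝓡 n) ((𝓡 1).prod (𝓡 n)) ∞ (Ψ ∘ e) ∧
      IsConnected (range (Ψ ∘ e))ᶜ ∧
      range (Ψ ∘ e) ∩ {q | (q.2 : EuclideanSpace ℝ (Fin (n + 1))) 0 ≤ ℓ} =
        ({1} : Set Circle) ×ˢ
          {p : Metric.sphere (0 : EuclideanSpace ℝ (Fin (n + 1))) 1 |
            (p : EuclideanSpace ℝ (Fin (n + 1))) 0 ≤ ℓ} := by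
  haveI : Fact (finrank ℝ (EuclideanSpace ℝ (Fin (n + 1))) = n + 1) := ⟨finrank_euclideanSpace_fin⟩
  -- the north pole `N = e₀` and the height `⟪p, N⟫ = p₀`
  set N : Metric.sphere (0 : EuclideanSpace ℝ (Fin (n + 1))) 1 :=
    ⟨EuclideanSpace.single 0 1, by simp [PiLp.norm_single]⟩ with hN
  have hNin : ∀ p : Metric.sphere (0 : EuclideanSpace ℝ (Fin (n + 1))) 1,
      ⟪(p : EuclideanSpace ℝ (Fin (n + 1))), (N : EuclideanSpace ℝ (Fin (n + 1)))⟫ =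
        (p : EuclideanSpace ℝ (Fin (n + 1))) 0 := fun p ↦ by
    simp [hN, EuclideanSpace.inner_single_right]
  -- ### Step 1: rotate `p₀` to the south pole `-N`
  obtain ⟨A, hA⟩ : ∃ A : EuclideanSpace ℝ (Fin (n + 1)) ≃ₗᵢ[ℝ] EuclideanSpace ℝ (Fin (n + 1)),
      A (p₀ : EuclideanSpace ℝ (Fin (n + 1))) = -(N : EuclideanSpace ℝ (Fin (n + 1))) := by
    by_cases hp : (p₀ : EuclideanSpace ℝ (Fin (n + 1))) = -(N : EuclideanSpace ℝ (Fin (n + 1)))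
    · exact ⟨LinearIsometryEquiv.refl ℝ _, hp⟩
    · refine ⟨((ℝ ∙ ((p₀ : EuclideanSpace ℝ (Fin (n + 1))) -
        -(N : EuclideanSpace ℝ (Fin (n + 1)))))ᗮ).reflection, Submodule.reflection_sub ?_⟩
      rw [norm_neg, norm_eq_of_mem_sphere p₀, norm_eq_of_mem_sphere N]
  set h₁ := LinearIsometryEquiv.sphereDiffeomorph (n := n) A with hh₁
  have hh₁p : h₁ p₀ = -N := Subtype.ext (by
    rw [hh₁, LinearIsometryEquiv.coe_sphereDiffeomorph_apply, hA, coe_neg_sphere])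
  have hh₁ball : h₁ '' closedBall p₀ r = closedBall (-N) r := by
    have hiso : Isometry h₁ := by
      refine Isometry.of_dist_eq fun p q ↦ ?_
      rw [Subtype.dist_eq, Subtype.dist_eq]
      show dist (A p) (A q) = _
      exact A.dist_map _ _
    rw [← hh₁p]
    exact (IsometryEquiv.mk h₁.toEquiv hiso).image_closedBall p₀ r
  set Ψ₁ := (Diffeomorph.refl (𝓡 1) Circle ∞).prodCongr h₁ with hΨ₁
  have hflat₁ : Ψ₁ '' range e ∩ {q | q.2 ∈ closedBall (-N) r} =
      ({1} : Set Circle) ×ˢ closedBall (-N) r := by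
    rw [← hh₁ball]; exact image_prodCongr_inter_eq h₁ hflat
  -- restrict the flat tube to the radius `r' = min r 1`
  set r' := min r 1 with hr'def
  have hr' : 0 < r' := lt_min hr one_pos
  have hr'1 : r' ≤ 1 := min_le_right _ _
  have hr'r : r' ≤ r := min_le_left _ _
  have hflat₁' : Ψ₁ '' range e ∩ {q | q.2 ∈ closedBall (-N) r'} =
      ({1} : Set Circle) ×ˢ closedBall (-N) r' := by
    have hsub : closedBall (-N) r' ⊆ closedBall (-N) r := closedBall_subset_closedBall hr'r
    have step : Ψ₁ '' range e ∩ {q | q.2 ∈ closedBall (-N) r'} =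
        (Ψ₁ '' range e ∩ {q | q.2 ∈ closedBall (-N) r}) ∩ {q | q.2 ∈ closedBall (-N) r'} := by
      ext q
      simp only [mem_inter_iff, mem_setOf_eq]
      constructor
      · rintro ⟨h1, h2⟩; exact ⟨⟨h1, hsub h2⟩, h2⟩
      · rintro ⟨⟨h1, -⟩, h2⟩; exact ⟨h1, h2⟩
    rw [step, hflat₁]
    ext q
    simp only [mem_inter_iff, mem_prod, mem_singleton_iff, mem_setOf_eq]
    constructor
    · rintro ⟨⟨h1, -⟩, h2⟩; exact ⟨h1, h2⟩
    · rintro ⟨h1, h2⟩; exact ⟨⟨h1, hsub h2⟩, h2⟩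
  -- the small cap as a sub-level set of the height
  have hcap₁ : closedBall (-N) r' = {p : Metric.sphere (0 : EuclideanSpace ℝ (Fin (n + 1))) 1 |
      ⟪(p : EuclideanSpace ℝ (Fin (n + 1))), (N : EuclideanSpace ℝ (Fin (n + 1)))⟫ ≤
        r' ^ 2 / 2 - 1} := closedBall_neg_eq_setOf_inner_le N hr'.le
  have hℓ₁ : -1 < r' ^ 2 / 2 - 1 := by nlinarith
  have hℓ₁' : r' ^ 2 / 2 - 1 < 1 := by nlinarith
  -- ### Step 2: inflate the small cap to the cap `{p₀ ≤ ℓ}` (disc theorem)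
  obtain ⟨h₂, hh₂⟩ := exists_diffeomorph_image_cap_eq hn N hℓ₁ hℓ₁' hℓ hℓ'
  set Ψ₂ := (Diffeomorph.refl (𝓡 1) Circle ∞).prodCongr h₂ with hΨ₂
  have hflat₂ : Ψ₂ '' (Ψ₁ '' range e) ∩ {q | q.2 ∈ h₂ '' closedBall (-N) r'} =
      ({1} : Set Circle) ×ˢ (h₂ '' closedBall (-N) r') := image_prodCongr_inter_eq h₂ hflat₁'
  rw [hcap₁, hh₂] at hflat₂
  -- ### assemble
  refine ⟨Ψ₁.trans Ψ₂, isSmoothEmbedding_diffeomorph_comp_circleProdSphere _ he,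
    (isConnected_compl_range_diffeomorph_comp_iff _ e).2 hconn, ?_⟩
  have hrange : range ((Ψ₁.trans Ψ₂) ∘ e) = Ψ₂ '' (Ψ₁ '' range e) := by
    rw [range_comp, Diffeomorph.coe_trans, image_comp]
  rw [hrange]
  have hset1 : {q : Circle × Metric.sphere (0 : EuclideanSpace ℝ (Fin (n + 1))) 1 |
      (q.2 : EuclideanSpace ℝ (Fin (n + 1))) 0 ≤ ℓ} =
      {q | q.2 ∈ {p : Metric.sphere (0 : EuclideanSpace ℝ (Fin (n + 1))) 1 |
        ⟪(p : EuclideanSpace ℝ (Fin (n + 1))), (N : EuclideanSpace ℝ (Fin (n + 1)))⟫ ≤ ℓ}} := by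
    ext q; simp only [mem_setOf_eq, hNin]
  have hset2 : {p : Metric.sphere (0 : EuclideanSpace ℝ (Fin (n + 1))) 1 |
      (p : EuclideanSpace ℝ (Fin (n + 1))) 0 ≤ ℓ} =
      {p : Metric.sphere (0 : EuclideanSpace ℝ (Fin (n + 1))) 1 |
        ⟪(p : EuclideanSpace ℝ (Fin (n + 1))), (N : EuclideanSpace ℝ (Fin (n + 1)))⟫ ≤ ℓ} := by
    ext p; simp only [mem_setOf_eq, hNin]
  rw [hset1, hset2]
  exact hflat₂

end BudneyGabai2019_thm_3_13

end Literature.Topology.FourManifolds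

end
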